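import Literature.Computability.AlgebraicComplexity.BLMW11WeaklySkewToSkewProofs
import HarnessLib

/-!
# Skew (and weakly-skew) circuits under linear combinations

The corrected skew / weakly-skew complexity measures of `BLMW11KroneckerApproximation.lean`
(`skewComplexity`, `wsComplexity`: WELL-FORMED fan-in-two circuits) are sub-additive under
`k`-linear combinations:

* `ArithCircuit.LinCombSkew.exists_skew_linComb`: from well-formed fan-in-two skew circuits
  `Q i` (`i : Fin n`) and scalars `c i`, ONE well-formed fan-in-two skew circuit computing
  `∑ i, c i • (Q i).eval`, of size `∑ i, (Q i).size + (n + 1)` (disjoint union + an accumulator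
  chain, as a register program);
* `ArithCircuit.skewComplexity_sum_smul_le :
    skewComplexity (∑ i ∈ s, c i • f i) ≤ ∑ i ∈ s, skewComplexity (f i) + (s.card + 1)`,
  `ArithCircuit.skewComplexity_add_le`, `ArithCircuit.skewComplexity_smul_le`;
* `ArithCircuit.wsComplexity_sum_smul_le :
    wsComplexity (∑ i ∈ s, c i • f i) ≤ ∑ i ∈ s, 4 * wsComplexity (f i) + (s.card + 1)`
  (through `wsComplexity_le_skewComplexity` and `skewComplexity_le_four_mul_wsComplexity`).

These are the linear-algebra closure properties of `VP_ws` used tacitly in BLMW 2011 §9.3–§9.4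
(e.g. extracting the coefficient of `ε^q` in (9.4.1) by interpolation is a linear combination of
substituted circuits). [cite: BurgisserEtAl2011, §9.3–§9.4]

## References
* [BurgisserEtAl2011] Bürgisser–Landsberg–Manivel–Weyman 2011, §9.3–§9.4.
* [Burgisser2000] Bürgisser 2000, Def. 2.1 (the circuit model; (sub)additivity of complexity).
-/

universe u v

open MvPolynomial

namespace Literature.Computability.AlgebraicComplexity

namespace ArithCircuit

namespace LinCombSkew

variable {k : Type u} [CommSemiring k] {σ : Type v}

/-- The registers: `cell i l` = gate `l` of the `i`-th circuit, `acc t` = the partial linear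
combination `∑_{s<t} c_s • (Q s).eval`. [cite: Burgisser2000, Def. 2.1] -/
inductive CReg : Type
  /-- Gate `l` of circuit `i`. -/
  | cell (i l : ℕ) : CReg
  /-- The `t`-th partial sum of the linear combination. -/
  | acc (t : ℕ) : CReg
  deriving DecidableEq

/-- An operand of circuit `i`, read in the union program. [cite: Burgisser2000, Def. 2.1] -/
def tOp (i : ℕ) : Operand k σ → ROperand k σ CReg
  | .gate j => .reg (.cell i j)
  | .var x => .var x
  | .const c => .const c

/-- A gate of circuit `i`, read in the union program. [cite: Burgisser2000, Def. 2.1] -/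
def tGate (i : ℕ) : Gate k σ → RGate k σ CReg
  | .sum args => .sum (args.map fun a => (a.1, tOp i a.2))
  | .prod args => .prod (args.map (tOp i))

variable {n : ℕ} (Q : Fin n → ArithCircuit k σ) (c : Fin n → k)

/-- The `i`-th circuit (the empty circuit for `i ≥ n`). [cite: Burgisser2000, Def. 2.1] -/
def circ (i : ℕ) : ArithCircuit k σ :=
  if h : i < n then Q ⟨i, h⟩ else ⟨[], .const 0⟩

/-- The `i`-th scalar (junk `0`). [cite: Burgisser2000, Def. 2.1] -/
def coef (i : ℕ) : k :=
  if h : i < n then c ⟨i, h⟩ else 0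

/-- The defining gates: circuit gates copied, plus the accumulator chain
`acc (t+1) = acc t + c_t • out_t`. [cite: Burgisser2000, Def. 2.1] -/
def gateOf : CReg → RGate k σ CReg
  | .cell i l =>
    match (circ Q i).gates[l]? with
    | some g => tGate i g
    | none => .sum []
  | .acc 0 => .sum []
  | .acc (t + 1) =>
    if t < n then .sum [(1, .reg (.acc t)), (coef c t, tOp t (circ Q t).output)]
    else .sum [(1, .reg (.acc t))]

/-- The intended values. [cite: Burgisser2000, Def. 2.1] -/
noncomputable def val : CReg → MvPolynomial σ k
  | .cell i l => (circ Q i).gateVal l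
  | .acc t => ∑ s ∈ Finset.range (min t n), coef c s • (circ Q s).eval

/-- The total size of the circuits. [cite: Burgisser2000, Def. 2.1] -/
def totalSize : ℕ := ∑ i, (Q i).size

/-- The ranks: gate `l` of any circuit has rank `l`; the accumulators come after everything.
[folklore] -/
def rank : CReg → ℕ
  | .cell _ l => l
  | .acc t => totalSize Q + t

/-- The register list. [folklore] -/
def regs : List CReg :=
  ((List.range n).flatMap fun i => (List.range (circ Q i).size).map fun l => CReg.cell i l) ++
    (List.range (n + 1)).map CReg.acc

/-- The union register program. [cite: Burgisser2000, Def. 2.1] -/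
noncomputable def prog : RegProg k σ CReg where
  regs := regs Q
  rank := rank Q
  gateOf := gateOf Q c
  output := .reg (.acc n)

variable {Q c}

/-- `circ` below `n`. [folklore] -/
private theorem circ_of_lt {i : ℕ} (h : i < n) : circ Q i = Q ⟨i, h⟩ := by
  simp [circ, h]

/-- Sizes are bounded by the total size. [folklore] -/
private theorem size_circ_le (i : ℕ) : (circ Q i).size ≤ totalSize Q := by
  unfold circ totalSize
  split_ifs with h
  · exact Finset.single_le_sum (f := fun i => (Q i).size) (fun _ _ => Nat.zero_le _)
      (Finset.mem_univ (⟨i, h⟩ : Fin n))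
  · simp [size]

/-- List sums over `List.range` are `Finset.range` sums. [folklore] -/
private theorem sum_map_range (g : ℕ → ℕ) (m : ℕ) :
    ((List.range m).map g).sum = ∑ i ∈ Finset.range m, g i := by
  induction m with
  | zero => simp
  | succ m ih => rw [List.range_succ, List.map_append, List.sum_append, ih,
      Finset.sum_range_succ, List.map_singleton, List.sum_singleton]

/-- Length of the register list. [folklore] -/
private theorem length_regs : (regs Q).length = totalSize Q + (n + 1) := by
  rw [regs, List.length_append, List.length_map, List.length_range, List.length_flatMap]
  simp only [List.length_map, List.length_range]
  congr 1
  rw [sum_map_range, totalSize, ← Fin.sum_univ_eq_sum_range (fun i => (circ Q i).size) n]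
  exact Finset.sum_congr rfl fun i _ => by rw [circ_of_lt i.isLt]

/-- Membership of a cell register. [folklore] -/
private theorem cell_mem_regs {i l : ℕ} :
    CReg.cell i l ∈ regs Q ↔ i < n ∧ l < (circ Q i).size := by
  simp only [regs, List.mem_append, List.mem_flatMap, List.mem_range, List.mem_map,
    CReg.cell.injEq, reduceCtorEq, and_false, exists_false, or_false]
  constructor
  · rintro ⟨i', hi', l', hl', rfl, rfl⟩
    exact ⟨hi', hl'⟩
  · rintro ⟨hi, hl⟩
    exact ⟨i, hi, l, hl, rfl, rfl⟩

/-- Membership of an accumulator register. [folklore] -/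
private theorem acc_mem_regs {t : ℕ} : CReg.acc t ∈ regs Q ↔ t ≤ n := by
  simp [regs, List.mem_flatMap]

/-- Value of a translated operand of gate `l` of circuit `i` (well-formed case).
[cite: Burgisser2000, Def. 2.1] -/
private theorem eval_tOp {i l : ℕ} {g : Gate k σ} (hwf : (circ Q i).WellFormed)
    (hg : (circ Q i).gates[l]? = some g) {u : Operand k σ} (hu : u ∈ g.args) :
    (tOp i u).eval (val Q c) = (circ Q i).opVal l u := by
  cases u with
  | gate j =>
    have hj : j < l := hwf.1 l g hg _ hu
    simp [tOp, val, opVal_gate, hj]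
  | var x => rfl
  | const d => rfl

/-- Value of the translated output operand of circuit `i` (well-formed case).
[cite: Burgisser2000, Def. 2.1] -/
private theorem eval_tOp_output {i : ℕ} (hwf : (circ Q i).WellFormed) :
    (tOp i (circ Q i).output).eval (val Q c) = (circ Q i).eval := by
  rw [eval_eq_opVal_output]
  have key : ∀ u : Operand k σ, (circ Q i).output = u →
      (tOp i u).eval (val Q c) = (circ Q i).opVal (circ Q i).size u := by
    intro u hu
    cases u with
    | var x => rfl
    | const d => rfl
    | gate j =>
      have h := hwf.2
      rw [hu] at h
      change j < (circ Q i).size at h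
      simp [tOp, val, opVal_gate, h]
  exact key _ rfl

/-- Well-formedness of every `circ`. [folklore] -/
private theorem wellFormed_circ (hwf : ∀ i, (Q i).WellFormed) (i : ℕ) : (circ Q i).WellFormed := by
  unfold circ
  split_ifs with h
  · exact hwf _
  · exact ⟨fun i g hg => by simp at hg, trivial⟩

/-- **The union program is realized by the intended values.** [cite: Burgisser2000, Def. 2.1] -/
theorem realizes (hwf : ∀ i, (Q i).WellFormed) : (prog Q c).Realizes (val Q c) := by
  intro r
  change (gateOf Q c r).eval (val Q c) = val Q c r
  cases r with
  | cell i l =>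
    have hwfi := wellFormed_circ hwf i
    rcases hg : (circ Q i).gates[l]? with _ | ⟨args | args⟩
    · simp [gateOf, hg, val, RGate.eval, gateVal_of_le _ (List.getElem?_eq_none_iff.1 hg)]
    · simp only [gateOf, hg, tGate, val, RGate.eval, List.map_map, gateVal_of_sum _ hg]
      congr 1
      refine List.map_congr_left fun a ha => ?_
      simp only [Function.comp_apply]
      rw [eval_tOp hwfi hg (by simp only [Gate.args, List.mem_map]; exact ⟨a, ha, rfl⟩)]
    · simp only [gateOf, hg, tGate, val, RGate.eval, List.map_map, gateVal_of_prod _ hg]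
      congr 1
      refine List.map_congr_left fun u hu => ?_
      simp only [Function.comp_apply]
      rw [eval_tOp hwfi hg (by simpa [Gate.args] using hu)]
  | acc t =>
    cases t with
    | zero => simp [gateOf, val, RGate.eval]
    | succ t =>
      simp only [gateOf, val]
      split_ifs with h
      · simp only [RGate.eval, List.map_cons, List.map_nil, List.sum_cons, List.sum_nil, add_zero,
          one_smul, ROperand.eval_reg, val, eval_tOp_output (wellFormed_circ hwf t)]
        rw [show min (t + 1) n = min t n + 1 by omega, Finset.sum_range_succ,
          show min t n = t by omega]
      · simp only [RGate.eval, List.map_cons, List.map_nil, List.sum_cons, List.sum_nil, add_zero,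
          one_smul, ROperand.eval_reg, val]
        rw [show min (t + 1) n = min t n by omega]

/-- The value of the last accumulator is the linear combination. [cite: Burgisser2000, Def. 2.1] -/
theorem val_acc_n : val Q c (.acc n) = ∑ i, c i • (Q i).eval := by
  simp only [val, min_self]
  rw [← Fin.sum_univ_eq_sum_range (fun s => coef c s • (circ Q s).eval) n]
  refine Finset.sum_congr rfl fun i _ => ?_
  rw [circ_of_lt i.isLt, coef, dif_pos i.isLt]

omit [CommSemiring k] in
/-- Translated gates keep their fan-in. [cite: Burgisser2000, Def. 2.1] -/
private theorem fanIn_tGate (i : ℕ) (g : Gate k σ) :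
    (tGate i g : RGate k σ CReg).fanIn = g.fanIn := by
  cases g <;> simp [tGate, RGate.fanIn, Gate.fanIn, Gate.args]

omit [CommSemiring k] in
/-- Translated gates keep skewness. [cite: BurgisserEtAl2011, §9.4 (skew circuits)] -/
private theorem isSkew_tGate (i : ℕ) {g : Gate k σ} (h : g.IsSkew) :
    (tGate i g : RGate k σ CReg).IsSkew := by
  cases g with
  | sum args => trivial
  | prod args =>
    simp only [tGate, RGate.IsSkew, List.countP_map]
    simp only [Gate.IsSkew] at h
    have : (ROperand.isRegRef ∘ tOp i : Operand k σ → Bool) = Operand.isGateRef :=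
      funext fun u => by cases u <;> rfl
    rw [this]
    exact h

/-- Every register gate has fan-in at most two. [cite: Burgisser2000, Def. 2.1] -/
theorem fanIn_gateOf_le (h2 : ∀ i, (Q i).IsFanInTwo) (r : CReg) : (gateOf Q c r).fanIn ≤ 2 := by
  cases r with
  | cell i l =>
    rcases hg : (circ Q i).gates[l]? with _ | g
    · simp [gateOf, hg, RGate.fanIn]
    · simp only [gateOf, hg, fanIn_tGate]
      have hi : i < n := by
        by_contra hi
        simp [circ, hi] at hg
      rw [circ_of_lt hi] at hg
      exact h2 _ g (List.mem_of_getElem? hg)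
  | acc t =>
    cases t with
    | zero => simp [gateOf, RGate.fanIn]
    | succ t =>
      simp only [gateOf]
      split_ifs <;> simp [RGate.fanIn]

/-- Every register gate is skew. [cite: BurgisserEtAl2011, §9.4 (skew circuits)] -/
theorem isSkew_gateOf (hsk : ∀ i, (Q i).IsSkew) (r : CReg) : (gateOf Q c r).IsSkew := by
  cases r with
  | cell i l =>
    rcases hg : (circ Q i).gates[l]? with _ | g
    · simp [gateOf, hg, RGate.IsSkew]
    · simp only [gateOf, hg]
      have hi : i < n := by
        by_contra hi
        simp [circ, hi] at hg
      rw [circ_of_lt hi] at hg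
      exact isSkew_tGate i (hsk _ g (List.mem_of_getElem? hg))
  | acc t =>
    cases t with
    | zero => trivial
    | succ t =>
      simp only [gateOf]
      split_ifs <;> trivial

/-- **The union program is well ranked.** [cite: Burgisser2000, Def. 2.1] -/
theorem wellRanked (hwf : ∀ i, (Q i).WellFormed) : (prog Q c).WellRanked := by
  intro r hr r' hr'
  change r ∈ regs Q at hr
  change r' ∈ (gateOf Q c r).reads at hr'
  change r' ∈ regs Q ∧ rank Q r' < rank Q r
  cases r with
  | cell i l =>
    obtain ⟨hi, hl⟩ := cell_mem_regs.1 hr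
    have hwfi := wellFormed_circ hwf i
    rcases hg : (circ Q i).gates[l]? with _ | g
    · simp [gateOf, hg, RGate.reads] at hr'
    · simp only [gateOf, hg] at hr'
      -- a read register is `cell i j` for a gate operand `gate j` of `g`, `j < l`
      have key : ∃ u ∈ g.args, r' ∈ (tOp i u : ROperand k σ CReg).reads := by
        cases g with
        | sum args =>
          simp only [tGate, RGate.reads, List.flatMap_map, List.mem_flatMap] at hr'
          obtain ⟨a, ha, h⟩ := hr'
          exact ⟨a.2, by simp only [Gate.args, List.mem_map]; exact ⟨a, ha, rfl⟩, h⟩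
        | prod args =>
          simp only [tGate, RGate.reads, List.flatMap_map, List.mem_flatMap] at hr'
          obtain ⟨u, hu, h⟩ := hr'
          exact ⟨u, hu, h⟩
      obtain ⟨u, hu, h⟩ := key
      cases u with
      | var x => simp [tOp, ROperand.reads] at h
      | const d => simp [tOp, ROperand.reads] at h
      | gate j =>
        simp only [tOp, ROperand.reads_reg, List.mem_singleton] at h
        subst h
        have hj : j < l := hwfi.1 l _ hg _ hu
        exact ⟨cell_mem_regs.2 ⟨hi, hj.trans hl⟩, by simp only [rank]; exact hj⟩
  | acc t =>
    cases t with
    | zero => simp [gateOf, RGate.reads] at hr'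
    | succ t =>
      have ht : t + 1 ≤ n := acc_mem_regs.1 hr
      simp only [gateOf, if_pos (show t < n by omega), RGate.reads, List.flatMap_cons,
        List.flatMap_nil, ROperand.reads_reg, List.append_nil, List.mem_append,
        List.mem_singleton] at hr'
      rcases hr' with rfl | h
      · exact ⟨acc_mem_regs.2 (by omega), by simp [rank]⟩
      · have hwft := wellFormed_circ hwf t
        have key : ∀ u : Operand k σ, (circ Q t).output = u →
            r' ∈ (tOp t u : ROperand k σ CReg).reads → r' ∈ regs Q ∧ rank Q r' < rank Q (.acc (t + 1)) := by
          intro u hu h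
          cases u with
          | var x => simp [tOp, ROperand.reads] at h
          | const d => simp [tOp, ROperand.reads] at h
          | gate j =>
            simp only [tOp, ROperand.reads_reg, List.mem_singleton] at h
            subst h
            have ho := hwft.2
            rw [hu] at ho
            change j < (circ Q t).size at ho
            refine ⟨cell_mem_regs.2 ⟨by omega, ho⟩, ?_⟩
            have := size_circ_le (Q := Q) t
            simp only [rank]
            omega
        exact key _ rfl h

/-- **Linear combinations of skew circuits**: one well-formed fan-in-two skew circuit computing
`∑ i, c i • (Q i).eval`, of size `∑ i, |Q i| + (n + 1)`. [cite: Burgisser2000, Def. 2.1] -/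
theorem exists_skew_linComb (hwf : ∀ i, (Q i).WellFormed) (h2 : ∀ i, (Q i).IsFanInTwo)
    (hsk : ∀ i, (Q i).IsSkew) :
    ∃ R : ArithCircuit k σ, R.WellFormed ∧ R.IsFanInTwo ∧ R.IsSkew ∧
      R.eval = ∑ i, c i • (Q i).eval ∧ R.size = ∑ i, (Q i).size + (n + 1) := by
  have hW := wellRanked (c := c) hwf
  have hV := realizes (c := c) hwf
  have hout' : ∀ r' ∈ (prog Q c).output.reads, r' ∈ (prog Q c).regs := by
    intro r' hr'
    change r' ∈ [CReg.acc n] at hr'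
    rw [List.mem_singleton] at hr'
    subst hr'
    exact acc_mem_regs.2 le_rfl
  refine ⟨(prog Q c).compile, (prog Q c).wellFormed_compile hW hout',
    (prog Q c).isFanInTwo_compile fun r _ => fanIn_gateOf_le h2 r,
    (prog Q c).isSkew_compile fun r _ => isSkew_gateOf hsk r, ?_, ?_⟩
  · rw [(prog Q c).eval_compile hW hV hout']
    exact val_acc_n
  · rw [(prog Q c).size_compile]
    exact length_regs

end LinCombSkew

section Complexity

variable {k : Type u} [CommSemiring k] {σ : Type v}

/-- **`L_skew(∑ c_i f_i) ≤ ∑ L_skew(f_i) + (#terms + 1)`** (corrected skew complexity, every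
commutative semiring). [cite: Burgisser2000, Def. 2.1] -/
theorem skewComplexity_sum_smul_le {ι : Type*} (s : Finset ι) (c : ι → k)
    (f : ι → MvPolynomial σ k) :
    skewComplexity (∑ i ∈ s, c i • f i) ≤ ∑ i ∈ s, skewComplexity (f i) + (s.card + 1) := by
  classical
  choose Q hQwf hQ2 hQsk hQc hQsz using fun i : ι => HI16Skew.skewComplexity_attained (f i)
  obtain ⟨R, hRwf, hR2, hRsk, hRev, hRsz⟩ :=
    LinCombSkew.exists_skew_linComb (Q := fun j : Fin s.card => Q (s.equivFin.symm j))
      (c := fun j => c (s.equivFin.symm j)) (fun j => hQwf _) (fun j => hQ2 _) (fun j => hQsk _)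
  have hsum : ∑ j : Fin s.card, c ((s.equivFin.symm j : s) : ι) •
      (Q ((s.equivFin.symm j : s) : ι)).eval = ∑ i ∈ s, c i • f i := by
    rw [← Finset.sum_coe_sort s (fun i => c i • f i),
      ← s.equivFin.symm.sum_comp (fun i : {x // x ∈ s} => c (i : ι) • f (i : ι))]
    exact Finset.sum_congr rfl fun j _ => by rw [(hQc _ : (Q _).eval = _)]
  have hsize : ∑ j : Fin s.card, (Q ((s.equivFin.symm j : s) : ι)).size =
      ∑ i ∈ s, skewComplexity (f i) := by
    rw [← Finset.sum_coe_sort s (fun i => skewComplexity (f i)),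
      ← s.equivFin.symm.sum_comp (fun i : {x // x ∈ s} => skewComplexity (f (i : ι)))]
    exact Finset.sum_congr rfl fun j _ => hQsz _
  have h := skewComplexity_le_size (f := ∑ i ∈ s, c i • f i) R hRwf hR2 hRsk
    (by rw [Computes, hRev, hsum])
  rw [hRsz, hsize] at h
  exact h

/-- `L_skew(f + g) ≤ L_skew(f) + L_skew(g) + 3`. [cite: Burgisser2000, Def. 2.1] -/
theorem skewComplexity_add_le (f g : MvPolynomial σ k) :
    skewComplexity (f + g) ≤ skewComplexity f + skewComplexity g + 3 := by
  have h := skewComplexity_sum_smul_le (Finset.univ : Finset (Fin 2)) (fun _ => (1 : k)) ![f, g]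
  simp only [one_smul, Fin.sum_univ_two, Matrix.cons_val_zero, Matrix.cons_val_one,
    Finset.card_univ, Fintype.card_fin] at h
  omega

/-- `L_skew(c • f) ≤ L_skew(f) + 2`. [cite: Burgisser2000, Def. 2.1] -/
theorem skewComplexity_smul_le (c : k) (f : MvPolynomial σ k) :
    skewComplexity (c • f) ≤ skewComplexity f + 2 := by
  have h := skewComplexity_sum_smul_le (Finset.univ : Finset (Fin 1)) (fun _ => c) ![f]
  simp only [Fin.sum_univ_one, Matrix.cons_val_fin_one, Finset.card_univ,
    Fintype.card_fin] at h
  omega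

/-- **`L_ws(∑ c_i f_i) ≤ ∑ 4·L_ws(f_i) + (#terms + 1)`** (corrected weakly-skew complexity).
[cite: BurgisserEtAl2011, §9.3–§9.4] -/
theorem wsComplexity_sum_smul_le {ι : Type*} (s : Finset ι) (c : ι → k)
    (f : ι → MvPolynomial σ k) :
    wsComplexity (∑ i ∈ s, c i • f i) ≤ ∑ i ∈ s, 4 * wsComplexity (f i) + (s.card + 1) := by
  refine (HI16Skew.wsComplexity_le_skewComplexity _).trans
    ((skewComplexity_sum_smul_le s c f).trans ?_)
  gcongr with i hi
  exact skewComplexity_le_four_mul_wsComplexity (f i)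

end Complexity

end ArithCircuit

end Literature.Computability.AlgebraicComplexity
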